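import Summits.ResolutionOfSingularities.ResolutionOfSingularities.Theorems.PurelyInseparableDim4ChartCentreEscape
import Summits.ResolutionOfSingularities.ResolutionOfSingularities.Theorems.PurelyInseparableDim4ChartChainStep
import HarnessLib

/-!
# Purely inseparable four-folds `z^p + F(x₁, …, x₄)`: CENTRE ESCAPE AT ANY DEPTH (brick TY-2 (h) part 5b of
# cell `res-dim4-pi`)

[OURS · counted 0] (D-0157 DOOR 2; director-resolution DR-157-C; frame caveat FC-2 «centre escape»). Sequel of
`PurelyInseparableDim4ChartCentreEscape.lean` (depth one: after a blow-up of `𝔸⁵` along `V(z, x_S)` the walk's next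
centre read on the re-centred `x_j`-chart is closed iff `S.erase j ⊆ S'`) and `PurelyInseparableDim4ChartChainStep.lean`
(the chart of a chart `φ'' = Spec Θ' ≫ chartImm_{j'} ≫ (π₂⁻¹ φ(𝔸⁵) ↪ W₂)` of a blowing up `π₂` of an arbitrary ambient
`Z` along the global centre `Z_c` of `V(z, x_{S'})`). PROVED here (no `sorry`, no new axiom):

* **`not_isClosed_image_CΛ_chart_of_chart`** — at ANY depth: if some variable `xᵢ` of the blown-up centre,
  `i ∈ S' ∖ {j'}`, is not among the variables of the next centre (`i ∉ S''`), then `φ''(V(z, x_{S''}))` is NOT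
  closed in `W₂` (it is not even closed in the open `π₂⁻¹ φ(𝔸⁵)`, which over the chart is a blowing up of `𝔸⁵`
  along `V(z, x_{S'})` — the depth-one escape);
* `isClosed_image_CΛ_chart_of_chart_imp` — hence closedness of the next chart centre forces `S'.erase j' ⊆ S''`.

Together with `isClosed_image_CΛ_chart_of_chart` (`S' ⊆ S''` ⇒ closed) this leaves exactly the steps with
`S'.erase j' ⊆ S''`, `j' ∉ S''` undecided at depth `≥ 3` (there closedness depends on the fibre directions of the
EARLIER blow-ups — honest gap). Nothing here is a statement about resolution of singularities in dimension ≥ 4 /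
characteristic `p` (NOT proved anywhere in this programme). bears_on: LADDER-RESOLUTION:D157-DOOR2 (res-dim4-pi).
Supports stmt-ResolutionOfSingularities-16155 (helper, TY-2 (h)).
-/

-- every declaration of this summit lives under `Summit.ResolutionOfSingularities.ResolutionOfSingularities`
-- (summit = problem), which the duplicate-namespace linter flags; house convention (cf. the Target file).
set_option linter.dupNamespace false

noncomputable section

open MvPolynomial Finset CategoryTheory AlgebraicGeometry Opposite TopologicalSpace
open AlgebraicGeometry.Scheme.IdealSheafData (ofIdealTop vanishingIdeal)

namespace Summit.ResolutionOfSingularities.ResolutionOfSingularities.Theorems.PIDim4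

open Literature.AlgebraicGeometry.Resolution
open Literature.AlgebraicGeometry.Resolution.AffinePointBlowup (P A γ coord Wtop)

namespace ChartDictionary

section EscapeStep

variable {K : Type} [Field K] {Z W₂ : Scheme.{0}} (φ : P 4 K ⟶ Z) [IsOpenImmersion φ] {π₂ : W₂ ⟶ Z}
  {S' S'' : Finset (Fin 4)} {i j' : Fin 4}

/-- **CENTRE ESCAPE AT ANY DEPTH.** For an open-immersion chart `φ : 𝔸⁵_K ⟶ Z`, ANY blowing up `π₂ : W₂ → Z` along
the global centre `Z_c` of `V(z, x_{S'})`, `j' ∈ S'`, a re-centring `Θ'` (`Θ' xₖ = xₖ + b'ₖ`, `b'_{j'} = 0`), and a next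
centre `S''` MISSING some `i ∈ S' ∖ {j'}`: the image of `V(z, x_{S''})` under the chart of the chart
`Spec Θ' ≫ chartImm_{j'} ≫ (π₂⁻¹ φ(𝔸⁵) ↪ W₂)` is NOT closed in `W₂`. -/
theorem not_isClosed_image_CΛ_chart_of_chart
    (hπ₂ : IsBlowup π₂ (vanishingIdeal (closureImage φ
      ((AffineCoordBlowup.𝓘Λ 4 K (insert 0 (Fin.succ '' (S' : Set (Fin 4))))).support : Set (P 4 K)))))
    (hj' : j' ∈ S') {b' : Fin 4 → K} (hbj' : b' j' = 0) {Θ' : A 4 K ≃ₐ[K] A 4 K}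
    (hs' : ∀ k : Fin 4, Θ' (X k.succ) = X k.succ + C (b' k)) (hiS' : i ∈ S') (hij : i ≠ j') (hiS'' : i ∉ S'') :
    ¬ IsClosed ((Spec.map (CommRingCat.ofHom (Θ' : A 4 K →+* A 4 K)) ≫
        AffineCoordBlowup.chartImm (isBlowup_restrict_globalCentre φ _ hπ₂) (succ_mem_centreVars hj') ≫
          (π₂ ⁻¹ᵁ φ.opensRange).ι) ''
      (AffineCoordBlowup.CΛ 4 K (insert 0 (Fin.succ '' (S'' : Set (Fin 4)))) : Set (P 4 K))) := by
  intro hT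
  -- the depth-one escape for the restricted blow-up `(π₂ |_{φ(𝔸⁵)}) ≫ e` of `𝔸⁵` along `V(z, x_{S'})`
  refine not_isClosed_image_CΛ_chart (S' := S'') hj' hbj' hs' (isBlowup_restrict_globalCentre φ _ hπ₂) hiS' hij hiS'' ?_
  -- a set inside the open `π₂⁻¹ φ(𝔸⁵)` which is closed in `W₂` is closed in the open
  have hcomp : ((Spec.map (CommRingCat.ofHom (Θ' : A 4 K →+* A 4 K)) ≫
        AffineCoordBlowup.chartImm (isBlowup_restrict_globalCentre φ _ hπ₂) (succ_mem_centreVars hj') ≫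
          (π₂ ⁻¹ᵁ φ.opensRange).ι : P 4 K ⟶ W₂) : P 4 K → W₂) =
      (π₂ ⁻¹ᵁ φ.opensRange).ι ∘ (Spec.map (CommRingCat.ofHom (Θ' : A 4 K →+* A 4 K)) ≫
        AffineCoordBlowup.chartImm (isBlowup_restrict_globalCentre φ _ hπ₂) (succ_mem_centreVars hj')) :=
    funext fun y => by simp only [Function.comp_apply, Scheme.Hom.comp_apply]
  rw [hcomp, Set.image_comp] at hT
  have hpre := hT.preimage (π₂ ⁻¹ᵁ φ.opensRange).ι.continuous
  rwa [Set.preimage_image_eq _ (π₂ ⁻¹ᵁ φ.opensRange).ι.isOpenEmbedding.injective] at hpre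

/-- **Closedness of the next chart centre forces `S'.erase j' ⊆ S''`** (any depth). -/
theorem isClosed_image_CΛ_chart_of_chart_imp
    (hπ₂ : IsBlowup π₂ (vanishingIdeal (closureImage φ
      ((AffineCoordBlowup.𝓘Λ 4 K (insert 0 (Fin.succ '' (S' : Set (Fin 4))))).support : Set (P 4 K)))))
    (hj' : j' ∈ S') {b' : Fin 4 → K} (hbj' : b' j' = 0) {Θ' : A 4 K ≃ₐ[K] A 4 K}
    (hs' : ∀ k : Fin 4, Θ' (X k.succ) = X k.succ + C (b' k))
    (hT : IsClosed ((Spec.map (CommRingCat.ofHom (Θ' : A 4 K →+* A 4 K)) ≫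
        AffineCoordBlowup.chartImm (isBlowup_restrict_globalCentre φ _ hπ₂) (succ_mem_centreVars hj') ≫
          (π₂ ⁻¹ᵁ φ.opensRange).ι) ''
      (AffineCoordBlowup.CΛ 4 K (insert 0 (Fin.succ '' (S'' : Set (Fin 4)))) : Set (P 4 K)))) :
    S'.erase j' ⊆ S'' := by
  intro i hi
  obtain ⟨hij, hiS'⟩ := Finset.mem_erase.mp hi
  by_contra hiS''
  exact not_isClosed_image_CΛ_chart_of_chart φ hπ₂ hj' hbj' hs' hiS' hij hiS'' hT

end EscapeStep

end ChartDictionary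

end Summit.ResolutionOfSingularities.ResolutionOfSingularities.Theorems.PIDim4

end
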